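import Mathlib
import HarnessLib
import Summits.NavierStokesRegularity.NavierStokesRegularity.Theorems.WakeRatchetMinimalViscousBlowupFrontClock

/-!
# Route `WakeRatchet`, crux `MinimalViscousBlowup` (stmt-NavierStokesRegularity-22743) — LINE g11-1 «threshold ray» (ns-idea-1 g11), reduction (C1) of
# STUB-PLAN-typeOneClock.md for stub S5 `stub_typeOneClock`: QUIET SHELLS, FIRED SHELLS, PRE-ARRIVAL TAILS

Front clock (FC), first-firing-time free, at the S4 level `c₀ = 1/(32768λ^{16})`: a shell `m` not fired on `[0,t]` forces `T − t ≤ K/λ^{2m}`.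
* `exists_nonfired_shell` — at every `t < T` some shell has not fired on `[0,t]` ((4.5) on `[0,(t+T)/2]`);
* `life_le_of_fired` — if shell `m` (quiet at `t = 0`) HAS fired by time `s`, then `T − s ≤ K/λ^{2m}` (first firing time as an infimum + (FC) just before it);
* `tails_of_nonfired` — a shell quiet on `[0,t]` traps the shells above it at `t`: `λ^{m+j}‖X_{m+j}(t)‖² ≤ c₀(2λ^{19})^{−j}ν²` (`valve_induction`).
MODEL lattice ODEs only; nothing here concerns the Navier–Stokes equations (no NS regularity statement is proved).
`--supports stmt-NavierStokesRegularity-22743 --as helper`.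
[cite: Tao2016AveragedNS, §4 Lemma 4.1 (4.5); BarbatoMorandinRomito2011, §3.1]
-/

noncomputable section

-- the summit and its single sub-problem share the name (CONVENTIONS §1)
set_option linter.dupNamespace false

open Set Filter Topology MeasureTheory

namespace Summit.NavierStokesRegularity.NavierStokesRegularity.Theorems.MinimalViscousBlowup.ThresholdRay

open Literature.Analysis.FluidPDE Literature.Analysis.FluidPDE.TaoCascade

/-! ### §1 Quiet shells, fired shells, pre-arrival tails -/

/-- At every time `t < T` of a trajectory that is (4.5)-regular on every `[0,T']`, some shell has not yet reached the level `c₀ν²` on `[0,t]`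
(`c₀ = 1/(32768λ^{16})`). [cite: Tao2016AveragedNS, §4 Lemma 4.1 (4.5)] -/
theorem exists_nonfired_shell {ε₀ ν T : ℝ} (hε : 0 < ε₀) (hν : 0 < ν) {X : Fin 4 → ℤ → ℝ → ℝ}
    (hreg : ∀ T' : ℝ, 0 < T' → T' < T → ∃ M : ℝ, ∀ t : ℝ, 0 ≤ t → t ≤ T' →
      ∀ (i : Fin 4) (n : ℤ), (1 + (1 + ε₀) ^ ((10 : ℝ) * n)) * |X i n t| ≤ M)
    {t : ℝ} (ht0 : 0 ≤ t) (htT : t < T) :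
    ∃ m : ℕ, ∀ s, 0 ≤ s → s ≤ t → (1 + ε₀) ^ m * ‖shellVec X m s‖ ^ 2 < 1 / (32768 * (1 + ε₀) ^ 16) * ν ^ 2 := by
  -- adapted from the proof of `clock_of_frontClock`
  have hl0 : (0 : ℝ) < 1 + ε₀ := by linarith
  set c₀ : ℝ := 1 / (32768 * (1 + ε₀) ^ 16) with hc₀
  have hc₀0 : 0 < c₀ := by rw [hc₀]; positivity
  set T' : ℝ := (t + T) / 2 with hT'
  have hT'0 : 0 < T' := by rw [hT']; linarith
  have htT' : t ≤ T' := by rw [hT']; linarith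
  have hT'T : T' < T := by rw [hT']; linarith
  obtain ⟨M₀, hM₀⟩ := hreg T' hT'0 hT'T
  set M : ℝ := max M₀ 0 with hMdef
  have hM0 : 0 ≤ M := le_max_right _ _
  have hdecay : ∀ s, 0 ≤ s → s ≤ t → ∀ m : ℕ,
      (1 + ε₀) ^ (19 * m) * ((1 + ε₀) ^ m * ‖shellVec X m s‖ ^ 2) ≤ 4 * M ^ 2 := by
    intro s hs0 hst m
    have hP : (0 : ℝ) < (1 + ε₀) ^ (10 * m) := pow_pos hl0 _
    have hX : ∀ i : Fin 4, |X i m s| ≤ M / (1 + ε₀) ^ (10 * m) := by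
      intro i
      have h := (hM₀ s hs0 (hst.trans htT') i m).trans (le_max_left M₀ 0)
      have hw : (1 + ε₀) ^ ((10 : ℝ) * ((m : ℕ) : ℤ)) = (1 + ε₀) ^ (10 * m) := by
        rw [show ((10 : ℝ) * (((m : ℕ) : ℤ) : ℝ)) = ((10 * m : ℕ) : ℝ) by push_cast; ring, Real.rpow_natCast]
      rw [hw] at h
      rw [le_div_iff₀ hP]
      nlinarith [abs_nonneg (X i m s)]
    have hn := norm_shellVec_le_two_mul (by positivity) hX
    have hsq : ‖shellVec X m s‖ ^ 2 ≤ (2 * (M / (1 + ε₀) ^ (10 * m))) ^ 2 := pow_le_pow_left₀ (norm_nonneg _) hn 2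
    calc (1 + ε₀) ^ (19 * m) * ((1 + ε₀) ^ m * ‖shellVec X m s‖ ^ 2)
        ≤ (1 + ε₀) ^ (19 * m) * ((1 + ε₀) ^ m * (2 * (M / (1 + ε₀) ^ (10 * m))) ^ 2) := by gcongr
      _ = 4 * M ^ 2 := by
          have hne : (1 + ε₀) ^ (10 * m) ≠ 0 := hP.ne'
          field_simp
          ring
  have h19 : (1 : ℝ) < (1 + ε₀) ^ 19 := one_lt_pow₀ (by linarith) (by norm_num)
  obtain ⟨m₁, hm₁⟩ := pow_unbounded_of_one_lt ((4 * M ^ 2 + 1) / (c₀ * ν ^ 2)) h19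
  refine ⟨m₁, fun s hs0 hst => ?_⟩
  have h1 := hdecay s hs0 hst m₁
  rw [← pow_mul] at hm₁
  rw [div_lt_iff₀ (by positivity)] at hm₁
  by_contra hcon
  have hge : c₀ * ν ^ 2 ≤ (1 + ε₀) ^ m₁ * ‖shellVec X (m₁ : ℤ) s‖ ^ 2 := not_lt.1 hcon
  have := mul_le_mul_of_nonneg_left hge (pow_nonneg hl0.le (19 * m₁))
  nlinarith

/-- **Fired shell ⇒ little life left.**  Under the front clock (FC), if shell `m`, quiet at `t = 0`, has reached the level `c₀ν²` at some time
`s' ≤ s < T`, then `T − s ≤ K/λ^{2m}` ((FC) applied just before the first firing time, an infimum attained by continuity). [folklore] -/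
theorem life_le_of_fired {ε₀ ν T K : ℝ} {X : Fin 4 → ℤ → ℝ → ℝ} (hcd : ∀ i n, ContDiffOn ℝ 1 (X i n) (Ico 0 T))
    (hFC : ∀ (m : ℕ) (t : ℝ), 0 ≤ t → t < T →
      (∀ s, 0 ≤ s → s ≤ t → (1 + ε₀) ^ m * ‖shellVec X m s‖ ^ 2 < 1 / (32768 * (1 + ε₀) ^ 16) * ν ^ 2) →
      T - t ≤ K / (1 + ε₀) ^ (2 * m))
    {m : ℕ} {s : ℝ} (hsT : s < T)
    (h0 : (1 + ε₀) ^ m * ‖shellVec X m 0‖ ^ 2 < 1 / (32768 * (1 + ε₀) ^ 16) * ν ^ 2)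
    (hfired : ∃ s', 0 ≤ s' ∧ s' ≤ s ∧ 1 / (32768 * (1 + ε₀) ^ 16) * ν ^ 2 ≤ (1 + ε₀) ^ m * ‖shellVec X m s'‖ ^ 2) :
    T - s ≤ K / (1 + ε₀) ^ (2 * m) := by
  obtain ⟨s', hs'0, hs's, hs'⟩ := hfired
  set c : ℝ := 1 / (32768 * (1 + ε₀) ^ 16) * ν ^ 2 with hc
  set ℓ : ℝ → ℝ := fun u => (1 + ε₀) ^ m * ‖shellVec X (m : ℤ) u‖ ^ 2 with hℓ
  -- `ℓ` is continuous on `[0, s]`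
  have hℓc : ContinuousOn ℓ (Icc 0 s) := by
    have heq : ℓ = fun u => (1 + ε₀) ^ m * ∑ i : Fin 4, X i m u ^ 2 := by
      funext u; simp only [hℓ]; rw [norm_shellVec_sq]
    rw [heq]
    refine continuousOn_const.mul (continuousOn_finsetSum _ fun i _ => ?_)
    exact ((hcd i m).continuousOn.mono fun u hu => ⟨hu.1, lt_of_le_of_lt hu.2 hsT⟩).pow 2
  -- the first firing time
  set S : Set ℝ := Icc 0 s ∩ ℓ ⁻¹' Ici c with hS
  have hSne : S.Nonempty := ⟨s', ⟨hs'0, hs's⟩, hs'⟩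
  have hSbdd : BddBelow S := ⟨0, fun u hu => hu.1.1⟩
  have hSclosed : IsClosed S := hℓc.preimage_isClosed_of_isClosed isClosed_Icc isClosed_Ici
  set s₀ : ℝ := sInf S with hs₀
  have hs₀S : s₀ ∈ S := hSclosed.csInf_mem hSne hSbdd
  have hs₀0 : 0 ≤ s₀ := hs₀S.1.1
  have hs₀s : s₀ ≤ s := hs₀S.1.2
  have hs₀pos : 0 < s₀ := by
    rcases hs₀0.eq_or_lt with h | h
    · exfalso
      have hmem : ℓ s₀ ≥ c := hs₀S.2
      rw [← h] at hmem
      exact absurd h0 (not_lt.2 hmem)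
    · exact h
  -- before `s₀` the shell is quiet, so (FC) applies
  have hquiet : ∀ t, 0 ≤ t → t < s₀ → ∀ u, 0 ≤ u → u ≤ t → ℓ u < c := by
    intro t ht0 hts₀ u hu0 hut
    by_contra hcon
    have hu : u ∈ S := ⟨⟨hu0, by linarith⟩, not_lt.1 hcon⟩
    have := csInf_le hSbdd hu
    linarith
  have hlife : ∀ t, 0 ≤ t → t < s₀ → T - t ≤ K / (1 + ε₀) ^ (2 * m) := fun t ht0 hts₀ =>
    hFC m t ht0 (by linarith) (hquiet t ht0 hts₀)
  -- pass to the limit `t ↑ s₀`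
  have hTs₀ : T - s₀ ≤ K / (1 + ε₀) ^ (2 * m) := by
    by_contra hcon
    have hgap : 0 < (T - s₀) - K / (1 + ε₀) ^ (2 * m) := by linarith [not_le.1 hcon]
    set t : ℝ := s₀ - min (s₀ / 2) (((T - s₀) - K / (1 + ε₀) ^ (2 * m)) / 2) with ht
    have hmin0 : 0 < min (s₀ / 2) (((T - s₀) - K / (1 + ε₀) ^ (2 * m)) / 2) := lt_min (by linarith) (by linarith)
    have h1 := hlife t (by rw [ht]; linarith [min_le_left (s₀ / 2) (((T - s₀) - K / (1 + ε₀) ^ (2 * m)) / 2)])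
      (by rw [ht]; linarith)
    rw [ht] at h1
    linarith [min_le_right (s₀ / 2) (((T - s₀) - K / (1 + ε₀) ^ (2 * m)) / 2)]
  linarith

/-- **Pre-arrival tails at the current time.**  A shell `m` quiet on `[0,t]` (`t < T`) traps the shells above it at time `t`:
`λ^{m+j}‖X_{m+j}(t)‖² ≤ c₀(2λ^{19})^{−j}ν²` (quietness persists a little beyond `t` by continuity; then `valve_induction`).
[cite: BarbatoMorandinRomito2011, §3.1] -/
theorem tails_of_nonfired {ε₀ ν T : ℝ} (hε : 0 < ε₀) (hν : 0 < ν)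
    {α : Fin 4 → Fin 4 → Fin 4 → ℤ × ℤ × ℤ → ℝ} (hcan : IsCancellingCoeff α) (hα1 : ∀ i₁ i₂ i₃, |α i₁ i₂ i₃ (0, 0, 1)| ≤ 1)
    {X₀ : Fin 4 → ℝ} {X : Fin 4 → ℤ → ℝ → ℝ}
    (hcd : ∀ i n, ContDiffOn ℝ 1 (X i n) (Ico 0 T))
    (hinit : ∀ i n, X i n 0 = if n = 0 then X₀ i else 0)
    (hmot : ∀ i n t, 0 ≤ t → t < T → derivWithin (X i n) (Ici 0) t =
      quadTerm ε₀ α X i n t - ν * (1 + ε₀) ^ ((2 : ℝ) * n) * X i n t)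
    (hreg : ∀ T' : ℝ, 0 < T' → T' < T → ∃ M : ℝ, ∀ t : ℝ, 0 ≤ t → t ≤ T' →
      ∀ (i : Fin 4) (n : ℤ), (1 + (1 + ε₀) ^ ((10 : ℝ) * n)) * |X i n t| ≤ M)
    {m : ℕ} {t : ℝ} (ht0 : 0 ≤ t) (htT : t < T)
    (hnf : ∀ s, 0 ≤ s → s ≤ t → (1 + ε₀) ^ m * ‖shellVec X m s‖ ^ 2 < 1 / (32768 * (1 + ε₀) ^ 16) * ν ^ 2) :
    ∀ j : ℕ, (1 + ε₀) ^ (m + j) * ‖shellVec X ((m + j : ℕ) : ℤ) t‖ ^ 2 ≤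
      1 / (32768 * (1 + ε₀) ^ 16) / (2 * (1 + ε₀) ^ 19) ^ j * ν ^ 2 := by
  -- adapted from the proof of `clock_of_frontClock`
  set c₀ : ℝ := 1 / (32768 * (1 + ε₀) ^ 16) with hc₀
  have hc₀0 : 0 < c₀ := by rw [hc₀]; positivity
  have hcont : ContinuousWithinAt (fun s => (1 + ε₀) ^ m * ‖shellVec X (m : ℤ) s‖ ^ 2) (Ico 0 T) t := by
    have heq : (fun s => (1 + ε₀) ^ m * ‖shellVec X (m : ℤ) s‖ ^ 2) =
        fun s => (1 + ε₀) ^ m * ∑ i : Fin 4, X i m s ^ 2 := by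
      funext s; rw [norm_shellVec_sq]
    rw [heq]
    refine continuousWithinAt_const.mul ?_
    refine tendsto_finsetSum _ fun i _ => ?_
    exact (((hcd i m).continuousOn t ⟨ht0, htT⟩)).pow 2
  have hev : ∀ᶠ s in 𝓝[Ico 0 T] t, (1 + ε₀) ^ m * ‖shellVec X (m : ℤ) s‖ ^ 2 < c₀ * ν ^ 2 :=
    Filter.Tendsto.eventually_lt hcont tendsto_const_nhds (hnf t ht0 le_rfl)
  obtain ⟨δ, hδ, hball⟩ := Metric.mem_nhdsWithin_iff.1 hev
  set Tw : ℝ := min (t + δ) T with hTw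
  have htTw : t < Tw := lt_min (by linarith) htT
  have hTwT : Tw ≤ T := min_le_right _ _
  have hTw0 : 0 < Tw := lt_of_le_of_lt ht0 htTw
  have hwin : ∀ s, 0 ≤ s → s < Tw → (1 + ε₀) ^ m * ‖shellVec X (m : ℤ) s‖ ^ 2 ≤ c₀ * ν ^ 2 := by
    intro s hs0 hsw
    rcases le_or_gt s t with hst | hst
    · exact (hnf s hs0 hst).le
    · have hmem : s ∈ Metric.ball t δ ∩ Ico 0 T := by
        refine ⟨?_, hs0, lt_of_lt_of_le hsw hTwT⟩
        rw [Metric.mem_ball, Real.dist_eq, abs_of_pos (by linarith)]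
        linarith [min_le_left (t + δ) T]
      exact le_of_lt (hball hmem)
  intro j
  exact valve_induction (T := Tw) hε hν hTw0 hc₀0 le_rfl hcan hα1 (X₀ := X₀)
    (fun i k => (hcd i k).mono (Ico_subset_Ico_right hTwT)) hinit
    (fun i k s hs0 hsw => hmot i k s hs0 (lt_of_lt_of_le hsw hTwT))
    (fun T'' h0 hlt => hreg T'' h0 (lt_of_lt_of_le hlt hTwT)) m hwin j t ht0 htTw

end Summit.NavierStokesRegularity.NavierStokesRegularity.Theorems.MinimalViscousBlowup.ThresholdRay

end
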